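import Summits.HodgeConjecture.HodgeConjecture.Theorems.CyclicUnitaryPowersHodgeGenericDeckCommutators
import Summits.HodgeConjecture.HodgeConjecture.Theorems.CyclicUnitaryPowersNodalMeridianMonodromy
import Literature.AlgebraicGeometry.HodgeTheory.HodgeGenericPointsComeagre
import Literature.AlgebraicGeometry.HodgeTheory.CyclicCoverBaseChart
import HarnessLib

/-!
# Route `CyclicUnitaryPowers` — the CATTANI–DELIGNE–KAPLAN-FREE, ANALYTIC «very general» form of crux K1-A and of the
# rung-F-H1 leaf: deck-unitary commutators lie in the Hodge group, and the Hodge conjecture holds on ALL POWERS, for every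
# smooth `p`-cyclic surface `x₃^p = f` (`p ≥ 7` prime) whose coefficient vector lies OFF A MEAGRE SET — granted ONLY
# Griffiths' theorem (Voisin I Thm. 10.3: the Hodge bundles are holomorphic subbundles)

Prover seat `hodge-nonav-prover-Ax` (g11), cell `hodge-nonav`; helper file `--supports stmt-HodgeConjecture-19544`; sorry-free,
no definition, no new named fact.  HONEST FRAMING: the route's crux K1-A `VeryGeneralDeckCommutatorsInHg` and its leaf
`CyclicSurfacePowersHodge` are typed with the ALGEBRAIC «very general» (off countably many proper Zariski-closed subsets of
the coefficient space); passing from «Hodge generic» to THAT needs the algebraicity of Hodge loci (Cattani–Deligne–Kaplan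
1995 — the print input `PrintCattaniDeligneKaplan`, item stmt-HodgeConjecture-23152).  This file proves the ANALYTIC twin
— «off a MEAGRE subset of the coefficient space `ℂ^{TernaryIndex p}`» (Deligne 1972 Prop. 7.5 / André 1992 Lemma 4:
"the complement of some meager subset") — WITHOUT Cattani–Deligne–Kaplan, conditional on ONE classical print theorem,
`Griffiths1968_holomorphicHodgeSubbundles`.  Items 19544 / 19543 stay OPEN; rung F-H1 is not moved; nothing here says
HC ∕ HC_AV is proved.

Ingredients (all tree theorems): F1‡ `carlsonToledo1999_nodalMeridianLocalMonodromyBound_holds` (this seat, g10) feeding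
prover-Bx's CDK-free per-point core `hodgeConjectureFor_powers_of_hodgeGeneric_of_localMonodromyBound` /
`exists_deck_comm_of_hodgeGeneric_of_localMonodromyBound` (HC on all powers of every HODGE-GENERIC smooth `p`-cyclic
surface); the meagre form of Deligne's Baire argument and Griffiths ⇒ dichotomy of Hodge loci
(`exists_isMeagre_isHodgeGenericPoint_of_griffiths1968`, this seat, g11: the non-Hodge-generic points of the constructed
Carlson–Toledo family `cyclicCoverFamily p` form a meagre subset of its base `S(ℂ)`); the coefficient chart
`S(ℂ) ↪ ℂ^{TernaryIndex p}` is a topological embedding (`isEmbedding_coeffChart`, prover-Bx g8), so the image of a meagre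
set is meagre (`Topology.IsInducing.isMeagre_image`).

* §1 `coeffChart_cyclicCoverPoint` — the chart of the classifying point of `f` is the coefficient vector of `f`;
  `isMeagre_singleton_zero` — `{0}` is meagre in `ℂ^{TernaryIndex p}`;
  `exists_isMeagre_isHodgeGenericPoint_cyclicCoverFamily` — a meagre `M ⊆ ℂ^{TernaryIndex p}`, containing `0`, off which
  the classifying point of every `f` with smooth model is Hodge generic (granted Griffiths).
* §2 `exists_deck_comm_offMeagre_of_griffiths1968` — **analytic K1-A**: for every prime `p ≥ 7` a meagre `M` such that
  every `f` homogeneous of degree `p` with coefficient vector off `M` and every smooth projective `X ⊂ ℙ³` cut out by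
  `x₃^p − f` carry `σ : X ⟶ X` with the route's clauses `Deck ∧ Comm` (verbatim the `let`-block of the route decl).
* §3 `cyclicSurfacePowersHodge_offMeagre_of_griffiths1968` — **analytic leaf**: same quantifiers, conclusion
  `HodgeConjectureFor (2(k+1)) Y` for every `(k+1)`-fold self fibre power `Y` of `X`; and `dense_compl` remark: the
  complement of `M` is dense (Baire), so the conclusion is about a comeagre — in particular uncountable, dense — set of
  `p`-cyclic surfaces for every prime `p ≥ 7`.

## References
* [Deligne1972WeilK3] P. Deligne, La conjecture de Weil pour les surfaces K3, Invent. Math. 15 (1972), Prop. 7.5.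
* [Andre1992] Y. André, Mumford–Tate groups of mixed Hodge structures …, Compositio Math. 82 (1992), §4 Lemma 4, §5 Thm. 1.
* [VoisinHodgeI2002] C. Voisin, Hodge Theory and Complex Algebraic Geometry I, CUP 2002, §10.2.1 Thm. 10.3.
* [CarlsonToledo1999] J. A. Carlson, D. Toledo, Duke Math. J. 97 (1999), §§2, 5, 6, 7 (Thm. 7.1).
* [CarlsonMullerStachPeters2017] J. Carlson, S. Müller-Stach, C. Peters, Period Mappings and Period Domains, 2nd ed.,
  Def. 15.3.5, Lemma–Def. 15.3.7.
* [RamonMari2008] J. J. Ramón Marí, the K3 precedent of K2.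
* [CattaniDeligneKaplan1995] E. Cattani, P. Deligne, A. Kaplan, On the locus of Hodge classes, JAMS 8 (1995) — NOT used here.
-/

noncomputable section

set_option linter.dupNamespace false

namespace Summit.HodgeConjecture.HodgeConjecture.Theorems.CyclicUnitaryPowersGenericCyclicSurfacePowersHodge

open Literature.AlgebraicGeometry.Motives Literature.AlgebraicGeometry.HodgeTheory
open Literature.AlgebraicGeometry.HodgeTheory.BettiUniverse
open Literature.AlgebraicGeometry.Motives.UniversalHypersurface Literature.AlgebraicGeometry.HodgeTheory.UniversalHypersurface
open Literature.AlgebraicTopology.SingularHomology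
open CategoryTheory CategoryTheory.Limits _root_.Topology
open Summit.HodgeConjecture.HodgeConjecture.Theorems.CyclicUnitaryPowersHodgeGenericDeckCommutators
open Summit.HodgeConjecture.HodgeConjecture.Theorems.CyclicUnitaryPowersNodalMeridianMonodromy

/-! ### §1 The meagre exceptional set of coefficient vectors -/

/-- **The coefficient chart of the classifying point of `f` is the coefficient vector of `f`** (for `f` homogeneous of
degree `p` with nonsingular cyclic cover form). [cite: CarlsonToledo1999, §2 (held text p0004)] -/
theorem coeffChart_cyclicCoverPoint {p : ℕ} [NeZero p] {f : MvPolynomial (Fin 3) ℂ} (hf : f.IsHomogeneous p)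
    (hJ : SmoothHypersurface.IsNonsingularForm ℂ (cyclicCoverForm p f)) (e : TernaryIndex p) :
    (branchForm p (cyclicCoverPoint p f)).coeff e.1 = f.coeff e.1 := by
  rw [coeffChart_apply, cyclicCoverPoint_eq p hf hJ, pointAlgHomSpz_apply, pointHomSpz_pointOfFormSpz,
    CommRingCat.hom_ofHom, AlgHom.toRingHom_eq_coe, AlgHom.coe_toRingHom, ternaryCoeffHom_X]

/-- `{0}` is meagre in the coefficient space `ℂ^{TernaryIndex p}` (a closed point of a non-trivial normed space has empty
interior). [folklore] -/
theorem isMeagre_singleton_zero (p : ℕ) : IsMeagre ({0} : Set (TernaryIndex p → ℂ)) := by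
  haveI : Nonempty (TernaryIndex p) :=
    ⟨⟨Finsupp.single 0 p, by rw [Finsupp.degree_single]⟩⟩
  refine IsNowhereDense.isMeagre ?_
  rw [IsNowhereDense, closure_singleton, interior_singleton]

/-- **The meagre exceptional set** (granted Griffiths' theorem): for `p ≥ 2` there is a meagre `M ⊆ ℂ^{TernaryIndex p}`,
containing `0`, such that for every `f ≠ 0`-type form — `f` homogeneous of degree `p` with coefficient vector off `M` and
nonsingular cyclic cover form — the classifying point `cyclicCoverPoint p f` of the Carlson–Toledo family is HODGE GENERIC
(for the real Hodge models).  The non-generic points of `S(ℂ)` are meagre (`exists_isMeagre_isHodgeGenericPoint_of_griffiths1968`)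
and the coefficient chart is an embedding (`isEmbedding_coeffChart`). [cite: Deligne1972WeilK3, Prop. 7.5]
[cite: Andre1992, §4 Lemma 4] [cite: VoisinHodgeI2002, §10.2.1 Thm. 10.3] [cite: CarlsonToledo1999, §2] -/
theorem exists_isMeagre_isHodgeGenericPoint_cyclicCoverFamily (hG : Griffiths1968_holomorphicHodgeSubbundles)
    (p : ℕ) [NeZero p]
    (A : ∀ t : ComplexPoints (cyclicCoverBase p), HodgeModel 2 (fiberOver (cyclicCoverFamily p) t))
    (hA : ∀ t, (A t).IsHodgeSymmetric) :
    ∃ M : Set (TernaryIndex p → ℂ), IsMeagre M ∧ (0 : TernaryIndex p → ℂ) ∈ M ∧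
      ∀ f : MvPolynomial (Fin 3) ℂ, f.IsHomogeneous p →
        SmoothHypersurface.IsNonsingularForm ℂ (cyclicCoverForm p f) →
        (fun d : TernaryIndex p => f.coeff d.1) ∉ M →
        haveI : HodgeTensorFacts.{0, 0} := hodgeTensorFacts_holds
        haveI : ∀ t : ComplexPoints (cyclicCoverBase p),
            Module.Finite ℚ (bettiCohomology (fiberOver (cyclicCoverFamily p) t) 2) :=
          fun t => finite ((isSmoothProjectiveFamily_cyclicCoverFamily p).isSmoothProjective t) 2
        IsHodgeGenericPoint (cyclicCoverFamily p) 2 (cyclicCoverFamily_locallyTrivial p)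
          (isSmoothProjectiveFamily_cyclicCoverFamily p) A hA ⟨cyclicCoverPoint p f, Set.mem_univ _⟩ := by
  haveI : HodgeTensorFacts.{0, 0} := hodgeTensorFacts_holds
  haveI : ∀ t : ComplexPoints (cyclicCoverBase p),
      Module.Finite ℚ (bettiCohomology (fiberOver (cyclicCoverFamily p) t) 2) :=
    fun t => finite ((isSmoothProjectiveFamily_cyclicCoverFamily p).isSmoothProjective t) 2
  haveI := smoothOfRelativeDimension_baseSpz_hom ℂ 2 p (cyclicCoverSpz p)
  obtain ⟨MS, hMS, hgen⟩ := exists_isMeagre_isHodgeGenericPoint_of_griffiths1968 hG (cyclicCoverFamily p) 2 2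
    (0 + Nat.card (TernaryIndex p)) (isSmoothProjectiveFamily_cyclicCoverFamily p)
    (isQuasiProjectiveOver_baseSpz 2 p (cyclicCoverSpz p)) (cyclicCoverFamily_locallyTrivial p) A hA
  let χ : ComplexPoints (cyclicCoverBase p) → (TernaryIndex p → ℂ) := fun t e => (branchForm p t).coeff e.1
  refine ⟨χ '' MS ∪ {0}, ((isEmbedding_coeffChart p).isInducing.isMeagre_image hMS).union
    (isMeagre_singleton_zero p), Or.inr rfl, fun f hf hJ hfM => hgen _ fun hmem => hfM (Or.inl ?_)⟩
  exact ⟨cyclicCoverPoint p f, hmem, funext fun e => coeffChart_cyclicCoverPoint hf hJ e⟩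

/-! ### §2 Analytic K1-A: deck-unitary commutators in the Hodge group off a meagre set -/

/-- **Analytic K1-A, Cattani–Deligne–Kaplan-free** (granted Griffiths' theorem only).  For every prime `p ≥ 7` there is a
MEAGRE subset `M` of the coefficient space `ℂ^{TernaryIndex p}` of ternary forms of degree `p` such that every `f`
homogeneous of degree `p` with coefficient vector off `M`, and every smooth projective surface `X ⊂ ℙ³` cut out by
`x₃^p − f`, carry a morphism `σ : X ⟶ X` with the route's clauses `Deck` ((i)–(iv) of K1-A) and `Comm` (every commutator of
two deck-unitary automorphisms of `H²(X(ℂ); ℚ)` lies in the Hodge group) — the statement of crux K1-A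
`VeryGeneralDeckCommutatorsInHg` with «off countably many proper Zariski-closed subsets» replaced by «off a meagre set»
(Deligne 1972 Prop. 7.5 / André 1992 Lemma 4 + Thm. 1).  Proof: `M` of §1 for the real Hodge models; a form off `M` is
non-zero, its model is smooth (`IsSmoothProjective.of_iso` along `IsHypersurfaceCutOutBy.nonempty_iso_hypersurface`), hence
nonsingular, so its classifying point is Hodge generic, and prover-Bx's CDK-free core
`exists_deck_comm_of_hodgeGeneric_of_localMonodromyBound` at the PROVED F1‡ concludes.  CONDITIONAL on
`Griffiths1968_holomorphicHodgeSubbundles`; no Cattani–Deligne–Kaplan. [cite: Deligne1972WeilK3, Prop. 7.5]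
[cite: Andre1992, §4 Lemma 4 and §5 Thm. 1] [cite: CarlsonToledo1999, §6 (kdoublept) and §7 Theorem 7.1]
[cite: CarlsonMullerStachPeters2017, Lemma–Definition 15.3.7] [cite: VoisinHodgeI2002, §10.2.1 Thm. 10.3] -/
theorem exists_deck_comm_offMeagre_of_griffiths1968 (hG : Griffiths1968_holomorphicHodgeSubbundles) :
    open Literature.AlgebraicGeometry.Motives Literature.AlgebraicGeometry.HodgeTheory Literature.AlgebraicGeometry.HodgeTheory.BettiUniverse CategoryTheory.Limits in let pmul : List ℕ → List ℕ → List ℕ := fun a b => (List.range (a.length + b.length - 1)).map fun k => ((List.range (k + 1)).map fun i => a.getD i 0 * b.getD (k - i) 0).sum; let ehn : ℕ → ℕ → ℕ → ℕ := fun p j q => if (q + 1) * p < 3 + j then 0 else ((List.replicate 3 (List.replicate (p - 1) 1)).foldl pmul [1]).getD ((q + 1) * p - 3 - j) 0; let Deck : (p : ℕ) → (X : SchemeOver ℂ) → IsSmoothProjective 2 X → (X ⟶ X) → Prop := fun p X hX σ => pull σ 2 ^ p = 1 ∧ (∀ x y, tr hX (2 + 2) (cup X 2 2 (pull σ 2 x)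 (pull σ 2 y)) = tr hX (2 + 2) (cup X 2 2 x y)) ∧ Module.finrank ℚ ↥(Module.End.eigenspace (pull σ 2) 1) = 1 ∧ ∃ ζ : ℂ, IsPrimitiveRoot ζ p ∧ ∀ j q : ℕ, 1 ≤ j → j < p → q ≤ 2 → Module.finrank ℂ ↥(Module.End.eigenspace ((pull σ 2).baseChange ℂ) (ζ ^ j) ⊓ (hodge exists_isReal_hodgeModel_holds hX 2).piece ((2 : ℤ) - q) q) = ehn p j q; let Uni : (X : SchemeOver ℂ) → IsSmoothProjective 2 X → (X ⟶ X) → (bettiCohomology X 2 ≃ₗ[ℚ] bettiCohomology X 2) → Prop := fun X hX σ g => (∀ x, g (pull σ 2 x) = pull σ 2 (g x)) ∧ ∀ x y, tr hX (2 + 2) (cup X 2 2 (g x) (g y)) = tr hX (2 + 2) (cup X 2 2 x y); let Comm : (X : SchemeOver ℂ) → IsSmoothProjective 2 X → (X ⟶ X) → Prop := fun X hX σ => haveI := finite hX 2; haveI : HodgeTensorFacts.{0, 0} := hodgeTensorFacts_holds; ∀ g h : bettiCohomology X 2 ≃ₗ[ℚ] bettiCohomology X 2, Uni X hX σ g → Uni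 X hX σ h → g * h * g⁻¹ * h⁻¹ ∈ (hodge exists_isReal_hodgeModel_holds hX 2).hodgeGroup; ∀ ⦃p : ℕ⦄, p.Prime → 7 ≤ p → ∃ M : Set ({d : Fin 3 →₀ ℕ // d.degree = p} → ℂ), IsMeagre M ∧ ∀ f : MvPolynomial (Fin 3) ℂ, f.IsHomogeneous p → (fun d : {d : Fin 3 →₀ ℕ // d.degree = p} => f.coeff d.1) ∉ M → ∀ ⦃X : SchemeOver ℂ⦄ (hX : IsSmoothProjective 2 X), IsHypersurfaceCutOutBy 3 (MvPolynomial.X (Fin.last 3) ^ p - MvPolynomial.rename Fin.castSucc f) X → ∃ σ : X ⟶ X, Deck p X hX σ ∧ Comm X hX σ := by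
  intro pmul ehn Deck Uni Comm p hp h7
  haveI : NeZero p := ⟨hp.ne_zero⟩
  have hp2 : 2 ≤ p := by omega
  -- real (hence Hodge-symmetric) Hodge models of the fibres of the Carlson–Toledo family
  have hAm := fun t : ComplexPoints (cyclicCoverBase p) =>
    exists_isReal_hodgeModel_holds.exists_isHodgeSymmetric
      ((isSmoothProjectiveFamily_cyclicCoverFamily p).isSmoothProjective t)
  let A : ∀ t : ComplexPoints (cyclicCoverBase p), HodgeModel 2 (fiberOver (cyclicCoverFamily p) t) :=
    fun t => (hAm t).choose
  have hA : ∀ t, (A t).IsHodgeSymmetric := fun t => (hAm t).choose_spec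
  obtain ⟨M, hM, h0M, hgen⟩ := exists_isMeagre_isHodgeGenericPoint_cyclicCoverFamily hG p A hA
  refine ⟨M, hM, fun f hf hfM X hX hcut => ?_⟩
  have hf0 : f ≠ 0 := by
    intro h
    apply hfM
    have : (fun d : TernaryIndex p => f.coeff d.1) = 0 := funext fun d => by rw [h, MvPolynomial.coeff_zero]; rfl
    rw [this]
    exact h0M
  obtain ⟨e⟩ := hcut.nonempty_iso_hypersurface
  have hXF : IsSmoothProjective 2 (SmoothHypersurface.hypersurface
      (MvPolynomial.X (Fin.last 3) ^ p - MvPolynomial.rename Fin.castSucc f)) := hX.of_iso e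
  have hJ : SmoothHypersurface.IsNonsingularForm ℂ (cyclicCoverForm p f) :=
    CyclicCoverFormNonsingular.isNonsingularForm_cyclicCoverForm_of_isSmoothProjective hp2 hf hf0 hXF
  exact exists_deck_comm_of_hodgeGeneric_of_localMonodromyBound
    carlsonToledo1999_nodalMeridianLocalMonodromyBound_holds hp h7 f hf hf0 hXF A hA (hgen f hf hJ hfM) hX hcut

/-! ### §3 Analytic leaf: the Hodge conjecture on all powers off a meagre set -/

/-- **Analytic rung-F-H1 leaf, Cattani–Deligne–Kaplan-free** (granted Griffiths' theorem only).  For every prime `p ≥ 7`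
there is a MEAGRE subset `M` of the coefficient space `ℂ^{TernaryIndex p}` such that for every `f` homogeneous of degree
`p` with coefficient vector off `M`, every smooth projective surface `X ⊂ ℙ³` cut out by `x₃^p − f` and every
`(k+1)`-fold self fibre power `Y` of `X`: `HodgeConjectureFor (2(k+1)) Y` — the leaf `CyclicSurfacePowersHodge` with
«off countably many proper Zariski-closed subsets» replaced by «off a meagre set».  Proof: §1 + prover-Bx's
`hodgeConjectureFor_powers_of_hodgeGeneric_of_localMonodromyBound` (crux K2 and support S PROVED) at the PROVED F1‡.
CONDITIONAL on `Griffiths1968_holomorphicHodgeSubbundles`; items stay open; rung F-H1 not moved; HC not proved.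
[cite: Deligne1972WeilK3, Prop. 7.5] [cite: Andre1992, §4 Lemma 4 and §5 Thm. 1]
[cite: CarlsonToledo1999, §6 (kdoublept) and §7 Theorem 7.1] [cite: RamonMari2008, Thm. 3.3 (the K3 precedent of K2)]
[cite: VoisinHodgeI2002, §10.2.1 Thm. 10.3] -/
theorem cyclicSurfacePowersHodge_offMeagre_of_griffiths1968 (hG : Griffiths1968_holomorphicHodgeSubbundles) :
    ∀ ⦃p : ℕ⦄, p.Prime → 7 ≤ p → ∃ M : Set ({d : Fin 3 →₀ ℕ // d.degree = p} → ℂ), IsMeagre M ∧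
      ∀ f : MvPolynomial (Fin 3) ℂ, f.IsHomogeneous p →
        (fun d : {d : Fin 3 →₀ ℕ // d.degree = p} => f.coeff d.1) ∉ M →
        ∀ ⦃X : SchemeOver ℂ⦄, IsSmoothProjective 2 X →
          IsHypersurfaceCutOutBy 3 (MvPolynomial.X (Fin.last 3) ^ p - MvPolynomial.rename Fin.castSucc f) X →
          ∀ ⦃k : ℕ⦄ ⦃Y : SchemeOver ℂ⦄, (∃ π : Fin (k + 1) → (Y ⟶ X), Nonempty (IsLimit (Fan.mk Y π))) →
            HodgeConjectureFor (2 * (k + 1)) Y := by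
  intro p hp h7
  haveI : NeZero p := ⟨hp.ne_zero⟩
  have hp2 : 2 ≤ p := by omega
  have hAm := fun t : ComplexPoints (cyclicCoverBase p) =>
    exists_isReal_hodgeModel_holds.exists_isHodgeSymmetric
      ((isSmoothProjectiveFamily_cyclicCoverFamily p).isSmoothProjective t)
  let A : ∀ t : ComplexPoints (cyclicCoverBase p), HodgeModel 2 (fiberOver (cyclicCoverFamily p) t) :=
    fun t => (hAm t).choose
  have hA : ∀ t, (A t).IsHodgeSymmetric := fun t => (hAm t).choose_spec
  obtain ⟨M, hM, h0M, hgen⟩ := exists_isMeagre_isHodgeGenericPoint_cyclicCoverFamily hG p A hA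
  refine ⟨M, hM, fun f hf hfM X hX hcut k Y hY => ?_⟩
  have hf0 : f ≠ 0 := by
    intro h
    apply hfM
    have : (fun d : TernaryIndex p => f.coeff d.1) = 0 := funext fun d => by rw [h, MvPolynomial.coeff_zero]; rfl
    rw [this]
    exact h0M
  obtain ⟨e⟩ := hcut.nonempty_iso_hypersurface
  have hXF : IsSmoothProjective 2 (SmoothHypersurface.hypersurface
      (MvPolynomial.X (Fin.last 3) ^ p - MvPolynomial.rename Fin.castSucc f)) := hX.of_iso e
  have hJ : SmoothHypersurface.IsNonsingularForm ℂ (cyclicCoverForm p f) :=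
    CyclicCoverFormNonsingular.isNonsingularForm_cyclicCoverForm_of_isSmoothProjective hp2 hf hf0 hXF
  exact hodgeConjectureFor_powers_of_hodgeGeneric_of_localMonodromyBound
    carlsonToledo1999_nodalMeridianLocalMonodromyBound_holds hp h7 f hf hf0 hXF A hA (hgen f hf hJ hfM) hX hcut hY

/-- **The exceptional set is small**: a meagre subset of the coefficient space `ℂ^{TernaryIndex p}` has DENSE complement
(Baire), so the leaf's conclusion holds on a comeagre — dense, uncountable — set of coefficient vectors for every prime
`p ≥ 7`. [folklore] -/
theorem dense_compl_of_isMeagre {p : ℕ} {M : Set (TernaryIndex p → ℂ)} (hM : IsMeagre M) : Dense Mᶜ :=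
  dense_of_mem_residual hM

end Summit.HodgeConjecture.HodgeConjecture.Theorems.CyclicUnitaryPowersGenericCyclicSurfacePowersHodge

end
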